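import Summits.AtomisticToContinuum.BoseEinsteinCondensation.Theses.BECZeroCrossingDilute
import Summits.AtomisticToContinuum.BoseEinsteinCondensation.Theorems.BECZeroCrossingDiluteNearIsotropicDiluteBECPenalisedPerron
import Summits.AtomisticToContinuum.BoseEinsteinCondensation.Theorems.BECZeroCrossingDiluteNearIsotropicDiluteBECPlanarDeficit
import Summits.AtomisticToContinuum.BoseEinsteinCondensation.Theorems.BECZeroCrossingDiluteNearIsotropicDiluteBECInterchangeComparison
import Summits.AtomisticToContinuum.BoseEinsteinCondensation.Theorems.BECZeroCrossingDiluteNearIsotropicDiluteBECKineticVariational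
import Literature.MathematicalPhysics.QuantumLattice.SpinChainsAkltCorrelationProofs
import Literature.MathematicalPhysics.QuantumLattice.SpinChargeKinematics
import HarnessLib

/-!
# `AnchorExact` (support item stmt-AtomisticToContinuum-13907 of route BECZeroCrossingDilute):
# the exact `SU(2)` end `B_L(N,1) = N(L³ − N + 1)`

For `L ≥ 2` and `N ≤ L³` the tracial ground-state functional `ω` of the penalised ISOTROPIC
ferromagnet `K_L(N,1) = H_1 + 4L³(S³_tot + L³/2 − N)²` on `(ℤ/Lℤ)³` has
`Re ω((S¹_tot)² + (S²_tot)²) + N − L³/2 = N(L³ − N + 1)` (the hard-core-projected condensate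
`|S = L³/2, M = N − L³/2⟩`: `⟨S⁺_tot S⁻_tot⟩ = S(S+1) − M² + M`).

Proof = the four landed stubs of the line `birth` of the crux `NearIsotropicDiluteBEC` at `Δ = 1`:
Perron–Frobenius (`stub_penalisedPerron`) gives a unit sector ground vector `φ` spanning the ground
space, so `ω` is its vector state (`groundStateFunctional_eq_of_hasUniqueGroundState`); the
variational kinetic bound (`stub_kineticVariational`) at `Δ = 1` makes the nearest-neighbour
interchange form `Σ_{x∼y}Re⟨φ,(1−T_xy)φ⟩ ≤ C(1−1)N²/L³ = 0`; the comparison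
(`stub_interchangeComparison`) then kills the all-pairs form, which is a sum of nonnegative terms
(`nidB2_re_quad_eq`), and the planar-deficit identity (`stub_planarDeficit`) reads
`Re⟨φ,Qφ⟩ + N − L³/2 = N(L³−N+1) − ½·0`. Heims (1964); Tasaki (2020) §2.5; Tóth (1991).
-/

noncomputable section

namespace Summit.AtomisticToContinuum.BoseEinsteinCondensation.Cruxes.NearIsotropicDiluteBEC.Birth

open scoped BigOperators Matrix ComplexOrder
open Literature.MathematicalPhysics.QuantumLattice Literature.Probability.LatticeModels Matrix Complex Finset

/-- **At `Δ = 1` the all-pairs interchange deficit of the penalised ground vector vanishes**: for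
`L ≥ 2`, `N ≤ L³` and a unit sector ground vector `φ` of `K_L(N,1)`,
`Σ_{x,y} Re⟨φ,(1 − T_xy)φ⟩ = 0` (B3 at `Δ = 1` + B2 + termwise nonnegativity). [folklore] -/
theorem anchor_deficit_eq_zero (L : ℕ) [NeZero L] (hL : 2 ≤ L) (N : ℕ) (hN : N ≤ L ^ 3)
    (φ : TensorIndex (TorusSite 3 L) 2 → ℂ)
    (hφmem : φ ∈ (xxzHamiltonian 1 (torusGraph 3 L) (-1) 1 +
      (((3 + 1) * L ^ 3 : ℕ) : ℂ) • (totalSpin 1 2 + ((L : ℂ) ^ 3 / 2 - (N : ℂ)) • 1) ^ 2).groundSpace)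
    (hφpen : ((totalSpin 1 2 : Op (TorusSite 3 L) 2) + ((L : ℂ) ^ 3 / 2 - (N : ℂ)) • 1) *ᵥ φ = 0)
    (hφ1 : star φ ⬝ᵥ φ = 1) :
    ∑ x : TorusSite 3 L, ∑ y : TorusSite 3 L,
      (star φ ⬝ᵥ ((1 : Op (TorusSite 3 L) 2) - permOp (Equiv.swap x y)) *ᵥ φ).re = 0 := by
  obtain ⟨C₂, _hC₂, h2⟩ := stub_interchangeComparison
  obtain ⟨C₃, _hC₃, h3⟩ := stub_kineticVariational
  have e3 := h3 L hL N hN 1 zero_le_one le_rfl φ hφmem hφpen hφ1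
  have e2 := h2 L hL φ
  have hK0 : (∑ x : TorusSite 3 L, ∑ y : TorusSite 3 L,
      (if (torusGraph 3 L).Adj x y then
        (star φ ⬝ᵥ ((1 : Op (TorusSite 3 L) 2) - permOp (Equiv.swap x y)) *ᵥ φ).re else 0)) ≤ 0 := by
    have h0 : C₃ * (1 - 1) * (N : ℝ) ^ 2 / (L : ℝ) ^ 3 = 0 := by ring
    linarith
  have hnonneg : ∀ x y : TorusSite 3 L,
      0 ≤ (star φ ⬝ᵥ ((1 : Op (TorusSite 3 L) 2) - permOp (Equiv.swap x y)) *ᵥ φ).re := by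
    intro x y
    rw [nidB2_re_quad_eq]
    exact mul_nonneg (by norm_num) (Finset.sum_nonneg fun σ _ => sq_nonneg _)
  have hD0 : 0 ≤ ∑ x : TorusSite 3 L, ∑ y : TorusSite 3 L,
      (star φ ⬝ᵥ ((1 : Op (TorusSite 3 L) 2) - permOp (Equiv.swap x y)) *ᵥ φ).re :=
    Finset.sum_nonneg fun x _ => Finset.sum_nonneg fun y _ => hnonneg x y
  have hle : ∑ x : TorusSite 3 L, ∑ y : TorusSite 3 L,
      (star φ ⬝ᵥ ((1 : Op (TorusSite 3 L) 2) - permOp (Equiv.swap x y)) *ᵥ φ).re ≤ 0 := by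
    refine e2.trans ?_
    have hC5 : 0 ≤ C₂ * (L : ℝ) ^ 5 := by positivity
    have := mul_le_mul_of_nonneg_left hK0 hC5
    simpa using this
  exact le_antisymm hle hD0

end Summit.AtomisticToContinuum.BoseEinsteinCondensation.Cruxes.NearIsotropicDiluteBEC.Birth

open Literature.MathematicalPhysics.QuantumLattice Literature.Probability.LatticeModels Matrix
  Summit.AtomisticToContinuum.BoseEinsteinCondensation.Cruxes.NearIsotropicDiluteBEC.Birth in
/-- **`AnchorExact` (item stmt-AtomisticToContinuum-13907), proved and concluded BY NAME.** For
`L ≥ 2`, `N ≤ L³`: `B_L(N,1) = Re ω_pen((S¹_tot)² + (S²_tot)²) + N − L³/2 = N(L³ − N + 1)` — at the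
isotropic point the penalised sector ground state is the hard-core-projected condensate. From the
landed stubs A, B1, B2, B3 of the crux line (Perron vector `φ`; all-pairs interchange deficit of `φ`
vanishes at `Δ = 1`; planar-deficit identity; tracial functional = vector state of `φ`).
Heims (1964); Tasaki (2020) §2.5; Tóth (1991). [folklore] -/
theorem Summit.AtomisticToContinuum.BoseEinsteinCondensation.Theorems.AnchorExact_proof :
    Summit.AtomisticToContinuum.BoseEinsteinCondensation.Theses.BECZeroCrossingDilute.AnchorExact := by
  intro L _ hL N hN
  -- (A) the Perron vector at Δ = 1
  obtain ⟨φ, _hφnn, hφ1, hφpen, hφmem, hφspan⟩ := stub_penalisedPerron L hL N hN 1 zero_le_one le_rfl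
  -- (B1) + vanishing deficit
  have e1 := stub_planarDeficit L hL N hN φ hφpen hφ1
  have hD := anchor_deficit_eq_zero L hL N hN φ hφmem hφpen hφ1
  rw [hD, mul_zero, sub_zero] at e1
  -- the tracial ground-state functional is the vector state of `φ`
  set Kp : Op (TorusSite 3 L) 2 := xxzHamiltonian 1 (torusGraph 3 L) (-1) 1 +
    (((3 + 1) * L ^ 3 : ℕ) : ℂ) • (totalSpin 1 2 + ((L : ℂ) ^ 3 / 2 - (N : ℂ)) • 1) ^ 2 with hKp
  have hφ0 : φ ≠ 0 := by
    rintro rfl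
    simp at hφ1
  have hspan : Kp.groundSpace = ℂ ∙ φ := by
    refine le_antisymm ?_ ?_
    · intro ψ hψ
      obtain ⟨c, hc⟩ := hφspan ψ hψ
      rw [Submodule.mem_span_singleton]
      exact ⟨c, hc.symm⟩
    · rw [Submodule.span_le, Set.singleton_subset_iff]
      exact hφmem
  have huniq : Kp.HasUniqueGroundState := by
    show Module.finrank ℂ Kp.groundSpace = 1
    rw [hspan]
    exact finrank_span_singleton hφ0
  have hω : Kp.groundStateFunctional
      ((totalSpin 1 0 : Op (TorusSite 3 L) 2) * totalSpin 1 0 + totalSpin 1 1 * totalSpin 1 1) =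
      star φ ⬝ᵥ ((totalSpin 1 0 : Op (TorusSite 3 L) 2) * totalSpin 1 0 + totalSpin 1 1 * totalSpin 1 1) *ᵥ φ := by
    rw [groundStateFunctional_eq_of_hasUniqueGroundState huniq hφmem hφ0, hφ1, div_one]
  rw [hω]
  exact e1

end
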